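import Summits.QuantumFields.BalabanUV.Beta.D1BFx.ChartDefectCorrectorWords
import Summits.QuantumFields.BalabanUV.Beta.BorderedHessianSymmetry

/-!
# `BalabanUV.Beta.D1BFx.ChartDefectCorrectorWard` — road «BF-x», binder row D1, PART 24-hyb HEAD RE-PAIRED, the OWNER's leg (c2), PART 2:
# **THE LEGGED BORDER IS LINEAR IN THE CORRECTOR, AND ITS RESOLVENT SERIES TRUNCATES** —
# `Eᵀ∘bhK∘E = 0`, `Dsh n = (bhK n∘E)ᵀ − bhK n∘E` with `bhK n∘E` a pure border block (the coarse gradient of an1's `lam04`),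
# the twisted Ward sandwich at the road's kernel for a SPREAD generator commuting with the slice projector, and
# `G₀∘Dsh n∘G₀ = −(Ẽ∘G₀ + G₀∘Ẽᵀ)`, `GcombSh n 0 = G₀ − G₀∘Dsh n∘G₀ + Ẽ∘G₀∘Ẽᵀ` (`E := psiKS (ctrOff (d+1) n) n − idK`, `Ẽ := E∘axEc ρ_c n`).

WHAT IT TYPES ([folklore] kernel bookkeeping over landed letters BY NAME; no definition).
§1 `bhK n ∘ E`.  The field rows VANISH (`comp_bhK_E_inl`: the field block of `bhK` is `d*d`, blind to the pure-gauge output of the corrector —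
   `SymCorrectorTransport.comp_bhK_phiKS_inl_inl`, `comp_phiKS_inr_right`, `E = idK − Φ̂_S`); the multiplier columns vanish (`comp_E_inr_right`).
§2 TRANSPOSE.  `Eᵀ∘bhK n = −(bhK n∘E)ᵀ` (`comp_trK_E_bhK_eq_neg_trK`: `bhK` is sign-conjugate symmetric, `BorderedHessianSymmetry.trK_bhK`, and `E`
   has no mixed blocks) ⟹ **`Eᵀ∘bhK n∘E = 0`** (`comp_trK_E_bhK_E`) ⟹ with PART 1's `Dsh_eq_E_words`:
   **`Dsh n = (bhK n∘E)ᵀ − bhK n∘E`** (`Dsh_eq_trK_sub`) — the legged border's defect is the ANTISYMMETRISED BLOCK-MEAN SHIFT OF THE CORRECTOR,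
   LINEAR in `E`; reading the multiplier–field entry back through `DshAn1.Dsh_inr_inl`:
   `(bhK n∘E) x y (inr m) (inl β) = [proj n x = 0]·dz (lam04 n β y) m (x∕n)` (`comp_bhK_E_inr_inl`) — `𝒬∘E` IS the coarse gradient of an1's
   (0.4)-potential of the input bond.
§3 THE TWISTED WARD SANDWICH for a SPREAD `Λ` commuting with the slice projector (`ColumnGaugeInvariance.sandwich_of_relInv`'s halves with
   `Loc Λ` relaxed to `Spr Λ`): `RelInv K M P`, `Λ∘P = P∘Λ` ⟹ `K∘Λ∘M∘K = K∘Λ`, `K∘M∘Λ∘K = Λ∘K`.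
§4 AT THE ROAD's PIN `G₀ := coDressKBmAt ρ_c n (KInvStep n 0)` (`RelInv G₀ (bhK n) (axEc ρ_c n)`, `ChartDefectResolvent.relInv_G0bm_ctr`) with
   `Λ := Ẽ`, `Ẽᵀ` (both commute with `axEc`, PART 1 §2): `G₀∘bhK n∘Ẽ∘G₀ = Ẽ∘G₀`, `G₀∘Ẽᵀ∘bhK n∘G₀ = G₀∘Ẽᵀ`; hence
   **`G₀∘Dsh n∘G₀ = −(Ẽ∘G₀ + G₀∘Ẽᵀ)`** (`comp_G0_Dsh_G0`) — the FIRST-ORDER resolvent term of the legged border IS the first-order conjugation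
   term — and **`GcombSh n 0 = G₀ − G₀∘Dsh n∘G₀ + Ẽ∘G₀∘Ẽᵀ`** (`GcombSh_zero_eq_resolvent_truncated`): the whole tail
   `Σ_{k≥2} (−G₀∘Dsh)^k∘G₀` of `ChartDefectResolvent.GcombSh_zero_eq_sub_defect` is the ONE doubly face-pinned word `Ẽ∘G₀∘Ẽᵀ`.
   For (lead) (located, zero weight; no word priced): the kernel inserted in every word of `ChartDefectRepair.dressed_insertion_words_level0`,
   `G₀∘Dsh∘G′ = G₀ − G′ = −(Ẽ∘G₀ + G₀∘Ẽᵀ + Ẽ∘G₀∘Ẽᵀ)` (`comp_G0_Dsh_GcombSh`), carries NO border letter: one or two legs moved onto `Ẽ`.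

HONEST DEPENDENCY (cell records, verbatim): «continuum YM on T⁴ ⇐ BetaPertH ∧ nine spine estimates (0/9 proved); BetaPertH ⇐ (D1) ∧ (D4) ∧
CAP+tail; G-an2-4 gates asym, D1 and NE2/3/4.»  HONEST FRAMING (cell contract, verbatim): «discharging `BetaPertH` makes Bałaban's UV stability
UNCONDITIONAL — a real constructive-QFT result; it is NOT the continuum limit and NOT the Clay problem.»  THIS MODULE DISCHARGES NOTHING of the wall:
[folklore] finite-sum ∕ tame-kernel algebra over `SymCorrectorKernel` ∕ `SymCorrectorTransport` ∕ `BorderedHessianSymmetry` ∕ `DshAn1` ∕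
`ChartDefectResolvent` ∕ PART 1 BY NAME; it prices NO row and asserts NO n-law.  No definition, no `def … : Prop`, nothing cited, 0 sorry, default
heartbeats.  0∕4 row-D1 binders; (K) NOT closed; (J1) ONE OPEN ROW; NOT D1, NEVER «G-an2-4 closed», NOT `BetaPertH`, NOT continuum, NOT Clay.

ABSOLUTE RULE (cell charter, verbatim): «No internally-minted statement may enter as a cited fact. Every hypothesis is either kernel-proved in this
package or a verbatim quotation of a PUBLISHED theorem with page reference. The manuscript(s) under audit are NOT citable for their own disputed
steps — they are the thing under adjudication; programme-internal (2001/route/tribunal) claims are never citable.»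

Unit `b2b-balaban-beta-d1-p2` (road owner, gen 27), 2026-08-24; no existing file touched.
-/

noncomputable section

namespace Summit.QuantumFields.BalabanUV.Beta.D1BFx.ChartDefectCorrectorWard

open Finset
open scoped BigOperators
open Literature.Probability.LatticeModels (Torus.proj)
open Literature.MathematicalPhysics.QuantumFieldTheory
open Literature.MathematicalPhysics.QuantumFieldTheory.LatticeForm (quo)
open Literature.MathematicalPhysics.QuantumFieldTheory.Balaban1983to89
open Literature.MathematicalPhysics.QuantumFieldTheory.Balaban1983to89.Beta
open ExpKernelCalculus (MKer comp)
open HessKerSchurResolvent (idK idK_apply comp_idK_left comp_idK_right)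
open OneStepResolventKernel (Fib)
open OneStepKernelFamily (KInvStep)
open AffineAveraging (Site Form1 box toSite unitVec dz)
open AveragingContoursRooted (ctr ctrOff ctrOff_mem_box)
open Summit.QuantumFields.BalabanUV.Beta.TameKernelCalculus
open Summit.QuantumFields.BalabanUV.Beta.ChartConjugationRelative (RelInv spr_comp)
open Summit.QuantumFields.BalabanUV.Beta.RelInvCongruenceKernel (trK_idK)
open Summit.QuantumFields.BalabanUV.Beta.RelInvNullShift (spr_add)
open Summit.QuantumFields.BalabanUV.Beta.AxialDressingRooted (axEc spr_axEc trK_axEc coDressKBmAt)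
open Summit.QuantumFields.BalabanUV.Beta.BorderedHessian (bhK spr_bhK bhK_inl_inl_eq sgnK sgnK_apply sgnF_inl sgnF_inr comp_sgnK trK_sgnK
  sgnK_eq_self trK_bhK)
open Summit.QuantumFields.BalabanUV.Beta.DshAn1 (Dsh lam04 Dsh_inr_inl)
open Summit.QuantumFields.BalabanUV.Beta.CombChartStepJets (GcombSh)
open Summit.QuantumFields.BalabanUV.Beta.SymCorrectorKernel (psiKS phiKS spr_phiKS)
open Summit.QuantumFields.BalabanUV.Beta.SymCorrectorTransport (comp_phiKS_inr_right comp_bhK_phiKS_inl_inl)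
open Summit.QuantumFields.BalabanUV.Beta.D1BFx.ChartDefectResolvent (relInv_G0bm_ctr spr_G0bm_ctr GcombSh_zero_eq_sub_defect)
open Summit.QuantumFields.BalabanUV.Beta.D1BFx.ChartDefectCorrectorWords (E_inl_inr E_inr E_inr_right phiKS_eq_idK_sub_E spr_E
  comp_axEc_Etilde comp_Etilde_axEc Dsh_eq_E_words comp_E_G0_eq_comp_Etilde_G0 comp_G0_trK_E_eq_comp_G0_trK_Etilde GcombSh_zero_eq_conj_Etilde)

variable {d : ℕ}

/-! ## §1 `bhK n ∘ E` is one border block -/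

section BhKE

variable {n : ℕ} (hn : 0 < n) {r : Fin (d + 1) → ℕ} (hr : r ∈ box (d + 1) n)

omit hn hr in
/-- [folklore] `E = idK − Φ̂_S` (PART 1's `phiKS_eq_idK_sub_E`, rearranged). -/
theorem E_eq_idK_sub_phiKS (r : Fin (d + 1) → ℕ) (n : ℕ) : (psiKS r n - idK : MKer (d + 1) (Fib d)) = idK - phiKS r n := by
  rw [phiKS_eq_idK_sub_E]; abel

omit hn hr in
/-- [folklore] **THE MULTIPLIER COLUMNS OF `X ∘ E` VANISH** for ANY left factor `X` (the corrector's multiplier columns vanish termwise). -/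
theorem comp_E_inr_right (X : MKer (d + 1) (Fib d)) (r : Fin (d + 1) → ℕ) (n : ℕ) (x z : Site (d + 1)) (a : Fib d) (μ : Fin (d + 1)) :
    comp X (psiKS r n - idK) x z a (Sum.inr μ) = 0 := by
  unfold ExpKernelCalculus.comp
  have e : ∀ y, ∑ f : Fib d, X x y a f * (psiKS r n - idK : MKer (d + 1) (Fib d)) y z f (Sum.inr μ) = 0 := fun y =>
    Finset.sum_eq_zero fun f _ => by rw [E_inr_right, mul_zero]
  simp_rw [e]
  exact tsum_zero

include hn hr

/-- [folklore] `bhK n ∘ E = bhK n − bhK n ∘ Φ̂_S`. -/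
theorem comp_bhK_E_eq_sub : comp (bhK n) (psiKS r n - idK) = bhK n - comp (bhK n) (phiKS r n) := by
  rw [E_eq_idK_sub_phiKS, comp_sub_right_tame (spr_bhK hn).tame spr_idK.tame (spr_phiKS hn hr).tame, comp_idK_right]

/-- [folklore] **THE FIELD ROWS OF `bhK n ∘ E` VANISH**: `(bhK n ∘ E) x z (inl κ) b = 0` — the field block of the bordered Hessian is `d*d`, blind
to the pure gauge `E` writes (`comp_bhK_phiKS_inl_inl`: `(bhK∘Φ̂_S)_{ff} = (bhK)_{ff}`); the border column is untouched (`comp_phiKS_inr_right`). -/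
theorem comp_bhK_E_inl (x z : Site (d + 1)) (κ : Fin (d + 1)) (b : Fib d) : comp (bhK n) (psiKS r n - idK) x z (Sum.inl κ) b = 0 := by
  haveI : NeZero n := ⟨hn.ne'⟩
  rw [comp_bhK_E_eq_sub hn hr]
  show bhK n x z (Sum.inl κ) b - comp (bhK n) (phiKS r n) x z (Sum.inl κ) b = 0
  rcases b with β | μ
  · rw [comp_bhK_phiKS_inl_inl r hn, bhK_inl_inl_eq, sub_self]
  · rw [comp_phiKS_inr_right, sub_self]

omit hn hr in
/-- [folklore] The multiplier–multiplier entries of `bhK n ∘ E` vanish. -/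
theorem comp_bhK_E_inr_inr (x z : Site (d + 1)) (m μ : Fin (d + 1)) : comp (bhK n) (psiKS r n - idK) x z (Sum.inr m) (Sum.inr μ) = 0 :=
  comp_E_inr_right _ r n x z _ μ

end BhKE

/-! ## §2 `Eᵀ ∘ bhK n = −(bhK n ∘ E)ᵀ`, `Eᵀ ∘ bhK n ∘ E = 0`, and `Dsh` linear in `E` -/

section Transpose

variable {n : ℕ} (hn : 0 < n) {r : Fin (d + 1) → ℕ} (hr : r ∈ box (d + 1) n)

omit hn hr in
/-- [folklore] A kernel with vanishing DIAGONAL blocks is negated by `sgnK`. -/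
theorem sgnK_eq_neg {K : MKer (d + 1) (Fib d)} (h1 : ∀ x y κ l, K x y (Sum.inl κ) (Sum.inl l) = 0)
    (h2 : ∀ x y m m', K x y (Sum.inr m) (Sum.inr m') = 0) : sgnK K = -K := by
  funext x y a b
  rw [sgnK_apply]
  show _ = -K x y a b
  rcases a with κ | κ <;> rcases b with l | l
  · rw [h1]; ring
  · rw [sgnF_inl, sgnF_inr]; ring
  · rw [sgnF_inr, sgnF_inl]; ring
  · rw [h2]; ring

omit hn hr in
/-- [folklore] `E` has no mixed blocks: `sgnK E = E`. -/
theorem sgnK_E (r : Fin (d + 1) → ℕ) (n : ℕ) : sgnK (psiKS r n - idK : MKer (d + 1) (Fib d)) = psiKS r n - idK :=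
  sgnK_eq_self (fun x y κ l => E_inl_inr r n x y κ l) (fun x y m l => E_inr r n x y m (Sum.inl l))

include hn hr

/-- [folklore] **`Eᵀ ∘ bhK n = −(bhK n ∘ E)ᵀ`** — `trK (bhK n) = sgnK (bhK n)` (`BorderedHessianSymmetry.trK_bhK`), `sgnK E = E`, and `bhK n ∘ E` has no
diagonal blocks (§1). -/
theorem comp_trK_E_bhK_eq_neg_trK :
    comp (trK (psiKS r n - idK)) (bhK n) = -trK (comp (bhK n) (psiKS r n - idK : MKer (d + 1) (Fib d))) := by
  haveI : NeZero n := ⟨hn.ne'⟩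
  have h : comp (trK (psiKS r n - idK)) (bhK n) = trK (comp (trK (bhK n)) (psiKS r n - idK : MKer (d + 1) (Fib d))) := by
    rw [trK_comp, trK_trK]
  have h1 : ∀ x y κ l, trK (comp (bhK n) (psiKS r n - idK : MKer (d + 1) (Fib d))) x y (Sum.inl κ) (Sum.inl l) = 0 :=
    fun x y κ l => by rw [trK_apply]; exact comp_bhK_E_inl hn hr y x l _
  have h2 : ∀ x y m m', trK (comp (bhK n) (psiKS r n - idK : MKer (d + 1) (Fib d))) x y (Sum.inr m) (Sum.inr m') = 0 :=
    fun x y m m' => by rw [trK_apply]; exact comp_bhK_E_inr_inr y x m' m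
  rw [h, trK_bhK, ← sgnK_E r n, comp_sgnK, sgnK_E, trK_sgnK, sgnK_eq_neg h1 h2]

/-- [folklore] **`Eᵀ ∘ bhK n ∘ E = 0`** (every summand has a vanishing factor: the field rows of `bhK∘E` or the multiplier rows of `E`). -/
theorem comp_trK_E_bhK_E : comp (comp (trK (psiKS r n - idK)) (bhK n)) (psiKS r n - idK) = (0 : MKer (d + 1) (Fib d)) := by
  rw [comp_trK_E_bhK_eq_neg_trK hn hr, comp_neg_left, neg_eq_zero]
  funext x z a b
  show (∑' y, ∑ f : Fib d, trK (comp (bhK n) (psiKS r n - idK : MKer (d + 1) (Fib d))) x y a f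
      * (psiKS r n - idK : MKer (d + 1) (Fib d)) y z f b) = 0
  have e : ∀ y, ∑ f : Fib d, trK (comp (bhK n) (psiKS r n - idK : MKer (d + 1) (Fib d))) x y a f
      * (psiKS r n - idK : MKer (d + 1) (Fib d)) y z f b = 0 := fun y =>
    Finset.sum_eq_zero fun f _ => by
      rcases f with l | μ
      · rw [trK_apply, comp_bhK_E_inl hn hr, zero_mul]
      · rw [E_inr, mul_zero]
  simp_rw [e]
  exact tsum_zero

end Transpose

section DshLinear

variable (n : ℕ) [NeZero n]

/-- [folklore] **THE LEGGED BORDER's DEFECT IS LINEAR IN THE CORRECTOR**: `Dsh n = −(Eᵀ∘bhK n + bhK n∘E)`, `E := psiKS (ctrOff (d+1) n) n − idK`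
(PART 1's `Dsh_eq_E_words` with §2's `Eᵀ∘bhK∘E = 0`). -/
theorem Dsh_eq_neg_add :
    Dsh (d := d) n = -(comp (trK (psiKS (ctrOff (d + 1) n) n - idK)) (bhK n) + comp (bhK n) (psiKS (ctrOff (d + 1) n) n - idK)) := by
  have hn : 0 < n := Nat.pos_of_ne_zero (NeZero.ne n); have hr : ctrOff (d + 1) n ∈ box (d + 1) n := ctrOff_mem_box hn
  rw [Dsh_eq_E_words, comp_trK_E_bhK_E hn hr]
  abel

/-- [folklore] **… AND IT IS THE ANTISYMMETRISED BLOCK-MEAN SHIFT OF THE CORRECTOR**: `Dsh n = (bhK n∘E)ᵀ − bhK n∘E`. -/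
theorem Dsh_eq_trK_sub :
    Dsh (d := d) n = trK (comp (bhK n) (psiKS (ctrOff (d + 1) n) n - idK : MKer (d + 1) (Fib d)))
      - comp (bhK n) (psiKS (ctrOff (d + 1) n) n - idK) := by
  have hn : 0 < n := Nat.pos_of_ne_zero (NeZero.ne n); have hr : ctrOff (d + 1) n ∈ box (d + 1) n := ctrOff_mem_box hn
  rw [Dsh_eq_neg_add, comp_trK_E_bhK_eq_neg_trK hn hr]
  abel

/-- [folklore] **THE BORDER BLOCK OF `bhK n ∘ E` IS THE COARSE GRADIENT OF an1's (0.4)-POTENTIAL**: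
`(bhK n∘E) x y (inr m) (inl β) = [proj n x = 0]·dz (lam04 n β y) m (x∕n)` (read back from `DshAn1.Dsh_inr_inl` through `Dsh_eq_trK_sub`). -/
theorem comp_bhK_E_inr_inl (x y : Site (d + 1)) (m β : Fin (d + 1)) :
    comp (bhK n) (psiKS (ctrOff (d + 1) n) n - idK) x y (Sum.inr m) (Sum.inl β) = if Torus.proj n x = 0 then dz (lam04 n β y) m (quo n x) else 0 := by
  have h := congrFun (congrFun (congrFun (congrFun (Dsh_eq_trK_sub (d := d) n) x) y) (Sum.inr m)) (Sum.inl β)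
  rw [Dsh_inr_inl] at h
  have h' : Dsh n x y (Sum.inr m) (Sum.inl β)
      = trK (comp (bhK n) (psiKS (ctrOff (d + 1) n) n - idK : MKer (d + 1) (Fib d))) x y (Sum.inr m) (Sum.inl β)
        - comp (bhK n) (psiKS (ctrOff (d + 1) n) n - idK) x y (Sum.inr m) (Sum.inl β) := by
    rw [Dsh_inr_inl]; exact h
  rw [trK_apply, comp_E_inr_right, zero_sub, Dsh_inr_inl] at h'
  split_ifs at h' with hx
  · rw [if_pos hx]; linarith
  · rw [if_neg hx]; linarith

end DshLinear

/-! ## §3 The twisted Ward sandwich for a spread generator commuting with the slice projector -/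

section Ward

variable {D : ℕ} {F : Type*} [Fintype F] {K M P Λ : MKer D F}

/-- [folklore] **LEFT HALF**: `RelInv K M P` (all spread), `Λ` spread with `Λ∘P = P∘Λ` ⟹ `K∘Λ∘M∘K = K∘Λ` (`sandwich_of_relInv`'s `e1`, `Loc Λ` relaxed). -/
theorem sandwich_left_of_relInv (hK : Spr K) (hM : Spr M) (hP : Spr P) (hR : RelInv K M P) (hΛ : Spr Λ) (hΛP : comp Λ P = comp P Λ) :
    comp (comp (comp K Λ) M) K = comp K Λ := by
  obtain ⟨hPK, hKP, hKMP, hPMK⟩ := hR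
  have hΛM : Spr (comp Λ M) := spr_comp hΛ hM
  have hPM : Spr (comp P M) := spr_comp hP hM
  calc comp (comp (comp K Λ) M) K
      = comp (comp K (comp Λ M)) K := by rw [comp_assoc_tame hK.tame hΛ.tame hM.tame]
    _ = comp (comp (comp K P) (comp Λ M)) K := by rw [hKP]
    _ = comp (comp K (comp (comp P Λ) M)) K := by
        rw [← comp_assoc_tame hK.tame hP.tame hΛM.tame, comp_assoc_tame hP.tame hΛ.tame hM.tame]
    _ = comp (comp K (comp (comp Λ P) M)) K := by rw [hΛP]
    _ = comp (comp K (comp Λ (comp P M))) K := by rw [← comp_assoc_tame hΛ.tame hP.tame hM.tame]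
    _ = comp K (comp Λ (comp (comp P M) K)) := by
        rw [← comp_assoc_tame hK.tame (spr_comp hΛ hPM).tame hK.tame, ← comp_assoc_tame hΛ.tame hPM.tame hK.tame]
    _ = comp K (comp Λ P) := by rw [hPMK]
    _ = comp K (comp P Λ) := by rw [hΛP]
    _ = comp (comp K P) Λ := by rw [comp_assoc_tame hK.tame hP.tame hΛ.tame]
    _ = comp K Λ := by rw [hKP]

/-- [folklore] **RIGHT HALF**: `K∘M∘Λ∘K = Λ∘K` (`K∘M∘Λ∘K = K∘M∘Λ∘P∘K = (K∘M∘P)∘Λ∘K = P∘Λ∘K = Λ∘P∘K = Λ∘K`). -/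
theorem sandwich_right_of_relInv (hK : Spr K) (hM : Spr M) (hP : Spr P) (hR : RelInv K M P) (hΛ : Spr Λ) (hΛP : comp Λ P = comp P Λ) :
    comp (comp (comp K M) Λ) K = comp Λ K := by
  obtain ⟨hPK, hKP, hKMP, hPMK⟩ := hR
  have hKM : Spr (comp K M) := spr_comp hK hM
  calc comp (comp (comp K M) Λ) K
      = comp (comp (comp K M) Λ) (comp P K) := by rw [hPK]
    _ = comp (comp (comp (comp K M) Λ) P) K := by rw [comp_assoc_tame (spr_comp hKM hΛ).tame hP.tame hK.tame]
    _ = comp (comp (comp K M) (comp Λ P)) K := by rw [comp_assoc_tame hKM.tame hΛ.tame hP.tame]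
    _ = comp (comp (comp K M) (comp P Λ)) K := by rw [hΛP]
    _ = comp (comp (comp (comp K M) P) Λ) K := by rw [← comp_assoc_tame hKM.tame hP.tame hΛ.tame]
    _ = comp (comp P Λ) K := by rw [hKMP]
    _ = comp (comp Λ P) K := by rw [hΛP]
    _ = comp Λ (comp P K) := by rw [comp_assoc_tame hΛ.tame hP.tame hK.tame]
    _ = comp Λ K := by rw [hPK]

end Ward

/-! ## §4 At the road's pin: the first resolvent term is the first conjugation term; the series truncates -/

section Pin

variable (n : ℕ) [NeZero n]

/-- [folklore] `Ẽ` commutes with the slice projector (PART 1 §2). -/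
theorem comp_Etilde_axEc_comm :
    comp (comp (psiKS (ctrOff (d + 1) n) n - idK) (axEc (ctr (d + 1) n) n)) (axEc (ctr (d + 1) n) n)
      = comp (axEc (ctr (d + 1) n) n) (comp (psiKS (ctrOff (d + 1) n) n - idK) (axEc (ctr (d + 1) n) n)) := by
  have hn : 0 < n := Nat.pos_of_ne_zero (NeZero.ne n); have hr : ctrOff (d + 1) n ∈ box (d + 1) n := ctrOff_mem_box hn
  rw [comp_Etilde_axEc hn hr, comp_axEc_Etilde hn hr]

/-- [folklore] `Ẽᵀ` commutes with the slice projector (`trK_axEc`, `trK_comp`). -/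
theorem comp_trK_Etilde_axEc_comm :
    comp (trK (comp (psiKS (ctrOff (d + 1) n) n - idK) (axEc (ctr (d + 1) n) n))) (axEc (ctr (d + 1) n) n)
      = comp (axEc (ctr (d + 1) n) n) (trK (comp (psiKS (ctrOff (d + 1) n) n - idK) (axEc (ctr (d + 1) n) n))) := by
  have hn : 0 < n := Nat.pos_of_ne_zero (NeZero.ne n); have hr : ctrOff (d + 1) n ∈ box (d + 1) n := ctrOff_mem_box hn
  have h1 := congrArg trK (comp_Etilde_axEc hn hr (ctr (d + 1) n))
  have h2 := congrArg trK (comp_axEc_Etilde hn hr (ctr (d + 1) n))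
  rw [trK_comp (comp (psiKS (ctrOff (d + 1) n) n - idK) (axEc (ctr (d + 1) n) n)) (axEc (ctr (d + 1) n) n), trK_axEc] at h1
  rw [trK_comp (axEc (ctr (d + 1) n) n) (comp (psiKS (ctrOff (d + 1) n) n - idK) (axEc (ctr (d + 1) n) n)), trK_axEc] at h2
  rw [h2, h1]

/-- [folklore] **`G₀ ∘ bhK n ∘ Ẽ ∘ G₀ = Ẽ ∘ G₀`** (right sandwich at `RelInv G₀ (bhK n) (axEc ρ_c n)`, `Λ := Ẽ`). -/
theorem G0_bhK_Etilde_G0 :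
    comp (comp (comp (coDressKBmAt (ctr (d + 1) n) n (KInvStep (d := d) n 0)) (bhK n))
        (comp (psiKS (ctrOff (d + 1) n) n - idK) (axEc (ctr (d + 1) n) n))) (coDressKBmAt (ctr (d + 1) n) n (KInvStep (d := d) n 0))
      = comp (comp (psiKS (ctrOff (d + 1) n) n - idK) (axEc (ctr (d + 1) n) n)) (coDressKBmAt (ctr (d + 1) n) n (KInvStep (d := d) n 0)) := by
  have hn : 0 < n := Nat.pos_of_ne_zero (NeZero.ne n); have hr : ctrOff (d + 1) n ∈ box (d + 1) n := ctrOff_mem_box hn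
  exact sandwich_right_of_relInv spr_G0bm_ctr (spr_bhK hn) (spr_axEc _ n) relInv_G0bm_ctr (spr_comp (spr_E hn hr) (spr_axEc _ n))
    (comp_Etilde_axEc_comm n)

/-- [folklore] **`G₀ ∘ Ẽᵀ ∘ bhK n ∘ G₀ = G₀ ∘ Ẽᵀ`** (left sandwich, `Λ := Ẽᵀ`). -/
theorem G0_trK_Etilde_bhK_G0 :
    comp (comp (comp (coDressKBmAt (ctr (d + 1) n) n (KInvStep (d := d) n 0))
        (trK (comp (psiKS (ctrOff (d + 1) n) n - idK) (axEc (ctr (d + 1) n) n)))) (bhK n)) (coDressKBmAt (ctr (d + 1) n) n (KInvStep (d := d) n 0))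
      = comp (coDressKBmAt (ctr (d + 1) n) n (KInvStep (d := d) n 0)) (trK (comp (psiKS (ctrOff (d + 1) n) n - idK) (axEc (ctr (d + 1) n) n))) := by
  have hn : 0 < n := Nat.pos_of_ne_zero (NeZero.ne n); have hr : ctrOff (d + 1) n ∈ box (d + 1) n := ctrOff_mem_box hn
  exact sandwich_left_of_relInv spr_G0bm_ctr (spr_bhK hn) (spr_axEc _ n) relInv_G0bm_ctr (spr_comp (spr_E hn hr) (spr_axEc _ n)).trK
    (comp_trK_Etilde_axEc_comm n)

/-- [folklore] **`G₀ ∘ Dsh n ∘ G₀ = −(Ẽ ∘ G₀ + G₀ ∘ Ẽᵀ)`** — the legged border inserted between two road kernels is MINUS the first-order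
conjugation term (`Dsh = −(Eᵀ∘bhK + bhK∘E)`, `E∘G₀ = Ẽ∘G₀`, `G₀∘Eᵀ = G₀∘Ẽᵀ`, the two sandwiches). -/
theorem comp_G0_Dsh_G0 :
    comp (comp (coDressKBmAt (ctr (d + 1) n) n (KInvStep (d := d) n 0)) (Dsh n)) (coDressKBmAt (ctr (d + 1) n) n (KInvStep (d := d) n 0))
      = -(comp (comp (psiKS (ctrOff (d + 1) n) n - idK) (axEc (ctr (d + 1) n) n)) (coDressKBmAt (ctr (d + 1) n) n (KInvStep (d := d) n 0))
          + comp (coDressKBmAt (ctr (d + 1) n) n (KInvStep (d := d) n 0)) (trK (comp (psiKS (ctrOff (d + 1) n) n - idK) (axEc (ctr (d + 1) n) n)))) := by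
  have hn : 0 < n := Nat.pos_of_ne_zero (NeZero.ne n); have hr : ctrOff (d + 1) n ∈ box (d + 1) n := ctrOff_mem_box hn
  set E : MKer (d + 1) (Fib d) := psiKS (ctrOff (d + 1) n) n - idK with hE
  set Et : MKer (d + 1) (Fib d) := comp E (axEc (ctr (d + 1) n) n) with hEt
  set G₀ : MKer (d + 1) (Fib d) := coDressKBmAt (ctr (d + 1) n) n (KInvStep (d := d) n 0) with hG₀
  have hEs : Spr E := spr_E hn hr
  have hEts : Spr Et := spr_comp hEs (spr_axEc _ n)
  have hG : Spr G₀ := spr_G0bm_ctr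
  have hB : Spr (bhK (d := d) n) := spr_bhK hn
  have hTB : Spr (comp (trK E) (bhK n)) := spr_comp hEs.trK hB
  have hBE : Spr (comp (bhK n) E) := spr_comp hB hEs
  have h1 : comp E G₀ = comp Et G₀ := by
    have h := comp_E_G0_eq_comp_Etilde_G0 (d := d) n
    rwa [← hE, ← hG₀, ← hEt] at h
  have h2 : comp G₀ (trK E) = comp G₀ (trK Et) := by
    have h := comp_G0_trK_E_eq_comp_G0_trK_Etilde (d := d) n
    rwa [← hE, ← hG₀, ← hEt] at h
  have hW1 : comp (comp (comp G₀ (bhK n)) Et) G₀ = comp Et G₀ := by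
    have h := G0_bhK_Etilde_G0 (d := d) n
    rwa [← hE, ← hG₀, ← hEt] at h
  have hW2 : comp (comp (comp G₀ (trK Et)) (bhK n)) G₀ = comp G₀ (trK Et) := by
    have h := G0_trK_Etilde_bhK_G0 (d := d) n
    rwa [← hE, ← hG₀, ← hEt] at h
  have hD : Dsh (d := d) n = -(comp (trK E) (bhK n) + comp (bhK n) E) := by
    have h := Dsh_eq_neg_add (d := d) n
    rwa [← hE] at h
  -- `G₀∘(EᵀbhK)∘G₀ = (G₀∘Eᵀ)∘bhK∘G₀ = (G₀∘Ẽᵀ)∘bhK∘G₀ = G₀∘Ẽᵀ`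
  have e1 : comp (comp G₀ (comp (trK E) (bhK n))) G₀ = comp G₀ (trK Et) := by
    rw [comp_assoc_tame hG.tame hEs.trK.tame hB.tame, h2, hW2]
  -- `G₀∘(bhK∘E)∘G₀ = G₀∘bhK∘(E∘G₀) = G₀∘bhK∘(Ẽ∘G₀) = Ẽ∘G₀`
  have e2 : comp (comp G₀ (comp (bhK n) E)) G₀ = comp Et G₀ := by
    rw [← comp_assoc_tame hG.tame hBE.tame hG.tame, ← comp_assoc_tame hB.tame hEs.tame hG.tame, h1,
      comp_assoc_tame hB.tame hEts.tame hG.tame, comp_assoc_tame hG.tame (spr_comp hB hEts).tame hG.tame,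
      comp_assoc_tame hG.tame hB.tame hEts.tame, hW1]
  rw [hD, comp_neg_right, comp_neg_left, comp_add_right_tame hG.tame hTB.tame hBE.tame,
    comp_add_left_tame (spr_comp hG hTB).tame (spr_comp hG hBE).tame hG.tame, e1, e2]
  abel

/-- [folklore] **THE RESOLVENT SERIES OF THE LEGGED BORDER TRUNCATES**: `GcombSh n 0 = G₀ − G₀∘Dsh n∘G₀ + Ẽ∘G₀∘Ẽᵀ` — the literal's kernel is the
road's, plus the first-order resolvent term, plus ONE doubly face-pinned word (PART 1's `GcombSh_zero_eq_conj_Etilde` expanded, with `comp_G0_Dsh_G0`). -/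
theorem GcombSh_zero_eq_resolvent_truncated :
    GcombSh (d := d) n 0
      = coDressKBmAt (ctr (d + 1) n) n (KInvStep (d := d) n 0)
        - comp (comp (coDressKBmAt (ctr (d + 1) n) n (KInvStep (d := d) n 0)) (Dsh n)) (coDressKBmAt (ctr (d + 1) n) n (KInvStep (d := d) n 0))
        + comp (comp (comp (psiKS (ctrOff (d + 1) n) n - idK) (axEc (ctr (d + 1) n) n)) (coDressKBmAt (ctr (d + 1) n) n (KInvStep (d := d) n 0)))
            (trK (comp (psiKS (ctrOff (d + 1) n) n - idK) (axEc (ctr (d + 1) n) n))) := by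
  have hn : 0 < n := Nat.pos_of_ne_zero (NeZero.ne n); have hr : ctrOff (d + 1) n ∈ box (d + 1) n := ctrOff_mem_box hn
  rw [comp_G0_Dsh_G0]
  set E : MKer (d + 1) (Fib d) := psiKS (ctrOff (d + 1) n) n - idK with hE
  set Et : MKer (d + 1) (Fib d) := comp E (axEc (ctr (d + 1) n) n) with hEt
  set G₀ : MKer (d + 1) (Fib d) := coDressKBmAt (ctr (d + 1) n) n (KInvStep (d := d) n 0) with hG₀
  have hI : Tame (idK : MKer (d + 1) (Fib d)) := spr_idK.tame
  have hEts : Spr Et := spr_comp (spr_E hn hr) (spr_axEc _ n)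
  have hG : Spr G₀ := spr_G0bm_ctr
  have hEG : Spr (comp Et G₀) := spr_comp hEts hG
  have h := GcombSh_zero_eq_conj_Etilde (d := d) n
  rw [← hE, ← hG₀, ← hEt, trK_add, trK_idK, comp_add_left_tame hI hEts.tame hG.tame, comp_idK_left,
    comp_add_right_tame (spr_add hG hEG).tame hI hEts.trK.tame, comp_idK_right, comp_add_left_tame hG.tame hEG.tame hEts.trK.tame] at h
  rw [h]
  abel

/-- [folklore] **THE INSERTED KERNEL OF THE (lead) WORDS CARRIES NO BORDER LETTER**: `G₀∘Dsh n∘GcombSh n 0 = G₀ − GcombSh n 0 = −(Ẽ∘G₀ + G₀∘Ẽᵀ + Ẽ∘G₀∘Ẽᵀ)`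
(`ChartDefectResolvent.GcombSh_zero_eq_sub_defect` with PART 1's `GcombSh_zero_eq_conj_Etilde` expanded) — the kernel `G₀∘X∘G′` inserted in every word of
`ChartDefectRepair.dressed_insertion_words_level0` (`X := Dsh n`) is the road's kernel with one or both legs moved onto the slice-internal corrector. -/
theorem comp_G0_Dsh_GcombSh :
    comp (comp (coDressKBmAt (ctr (d + 1) n) n (KInvStep (d := d) n 0)) (Dsh n)) (GcombSh (d := d) n 0)
      = -(comp (comp (psiKS (ctrOff (d + 1) n) n - idK) (axEc (ctr (d + 1) n) n)) (coDressKBmAt (ctr (d + 1) n) n (KInvStep (d := d) n 0))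
          + comp (coDressKBmAt (ctr (d + 1) n) n (KInvStep (d := d) n 0)) (trK (comp (psiKS (ctrOff (d + 1) n) n - idK) (axEc (ctr (d + 1) n) n)))
          + comp (comp (comp (psiKS (ctrOff (d + 1) n) n - idK) (axEc (ctr (d + 1) n) n)) (coDressKBmAt (ctr (d + 1) n) n (KInvStep (d := d) n 0)))
              (trK (comp (psiKS (ctrOff (d + 1) n) n - idK) (axEc (ctr (d + 1) n) n)))) := by
  have hn : 0 < n := Nat.pos_of_ne_zero (NeZero.ne n); have hr : ctrOff (d + 1) n ∈ box (d + 1) n := ctrOff_mem_box hn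
  have hsub := GcombSh_zero_eq_sub_defect (d := d) (Lc := n)
  have hconj := GcombSh_zero_eq_conj_Etilde (d := d) n
  set E : MKer (d + 1) (Fib d) := psiKS (ctrOff (d + 1) n) n - idK with hE
  set Et : MKer (d + 1) (Fib d) := comp E (axEc (ctr (d + 1) n) n) with hEt
  set G₀ : MKer (d + 1) (Fib d) := coDressKBmAt (ctr (d + 1) n) n (KInvStep (d := d) n 0) with hG₀
  have hI : Tame (idK : MKer (d + 1) (Fib d)) := spr_idK.tame
  have hEts : Spr Et := spr_comp (spr_E hn hr) (spr_axEc _ n)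
  have hG : Spr G₀ := spr_G0bm_ctr
  have hEG : Spr (comp Et G₀) := spr_comp hEts hG
  rw [trK_add, trK_idK, comp_add_left_tame hI hEts.tame hG.tame, comp_idK_left,
    comp_add_right_tame (spr_add hG hEG).tame hI hEts.trK.tame, comp_idK_right, comp_add_left_tame hG.tame hEG.tame hEts.trK.tame] at hconj
  calc comp (comp G₀ (Dsh n)) (GcombSh (d := d) n 0) = G₀ - GcombSh (d := d) n 0 := by
        conv_rhs => rw [hsub]
        abel
    _ = _ := by rw [hconj]; abel

end Pin

end Summit.QuantumFields.BalabanUV.Beta.D1BFx.ChartDefectCorrectorWard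

end
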